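import Literature.NumberTheory.GelbartRogawski1991.Prop311AdelicCoordinates
import HarnessLib

/-!
# [GelbartRogawski1991, §3.1]: the projections `H_𝐀(W) → H(W_∞)`, `H_𝐀(W) → H(W_fin)` in adelic Darboux coordinates

Topic `NumberTheory/GelbartRogawski1991`; namespace `Literature.NumberTheory.GelbartRogawski1991.Prop311`.  KERNEL
ONLY: theorems; no definition, no named fact, no `sorry`; `Prop311AsPrinted` itself is untouched.

Continuation of `Prop311AdelicCoordinates`: in the adelic Darboux coordinates `e : 𝐀ⁿ × 𝐀ⁿ ≃ W_𝐀` of the printed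
`H_𝐀(W) = Prop311.AdelicHeisenberg F E V Φ` ([GelbartRogawski1991, §3.1 p. 454 L17–22], `𝐀 = F_∞ × 𝐀_F^∞`), every
coordinate vector splits as `J_∞(arch c) + J_f(fin c)` (`coord_eq_arch_add_fin`, `arch_fin_coord`), the law
`heisForm = ½ φ_𝐀` splits accordingly (`heisForm_eq_arch_add_fin`), and `(w, t) ↦ (arch(e⁻¹ w), ι t_∞)`,
`(w, t) ↦ halfAltPolarEquiv (fin(e⁻¹ w), t_f)` are group homomorphisms onto the archimedean Heisenberg group
`Heisenberg (altPolar ·)` over `ℝ^{r₁} × ℂ^{r₂}` and the polarised finite-adelic one `Heisenberg (polar ·)` over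
`𝐀_F^∞` (`exists_archProj`, `exists_finProj`), with sections killing the other factor (`exists_proj_eq_one_fin`,
`exists_proj_eq_one_arch`) and the expected values on the centre (`proj_ofCenter`).  These are the maps along which
the EXISTENCE of the printed `ρ_ψ` (`Prop311RhoPsiExists`) pulls back the lattice model ⊗ Schrödinger model.

## References
* [GelbartRogawski1991] S. Gelbart, J. Rogawski, Invent. Math. 105 (1991), §3.1 p. 454 L17–22.
* [Weil1964] A. Weil, Acta Math. 111 (1964), Chap. I n° 3–4, Chap. III n° 37.
-/

set_option autoImplicit false

noncomputable section

open NumberField IsDedekindDomain NumberField.mixedEmbedding InfiniteAdeleRing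
open Literature.RepresentationTheory.HeisenbergGroup Literature.NumberTheory.Automorphic

namespace Literature.NumberTheory.GelbartRogawski1991

namespace Prop311

/-! ## §2 The projections of `H_𝐀(W)` onto its archimedean and finite parts in Darboux coordinates -/

section Coordinates

variable {F : Type} [Field F] [NumberField F]
variable {E : Type} [Field E] [Algebra F E]
variable {V : Type} [AddCommGroup V] [Module F V]
variable {Φ : V →ₗ[F] V →ₗ[F] E}
variable {n : ℕ}
  {e : ((Fin n → AdeleRing (𝓞 F) F) × (Fin n → AdeleRing (𝓞 F) F)) ≃ₗ[AdeleRing (𝓞 F) F] AdelicSpace F V}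
  (he : ∀ c c' : (Fin n → AdeleRing (𝓞 F) F) × (Fin n → AdeleRing (𝓞 F) F),
    adelicTraceForm F E V Φ (e c) (e c') = c.1 ⬝ᵥ c'.2 - c'.1 ⬝ᵥ c.2)

/-- the archimedean and finite coordinates recover a coordinate vector:
`c = J_∞(arch c) + J_f(fin c)` with the explicit `arch`, `fin` of `exists_eq_archCoord_add_finCoord`.
[cite: GelbartRogawski1991, §3.1 p. 454 L17–22] -/
theorem coord_eq_arch_add_fin (c : (Fin n → AdeleRing (𝓞 F) F) × (Fin n → AdeleRing (𝓞 F) F)) :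
    c = (fun i => 2 * infiniteAdeleInl F ((ringEquiv_mixedSpace F).symm
            (ringEquiv_mixedSpace F ((⅟(2 : AdeleRing (𝓞 F) F) * c.1 i).1))),
          fun i => infiniteAdeleInl F ((ringEquiv_mixedSpace F).symm (ringEquiv_mixedSpace F (c.2 i).1))) +
        (fun i => finiteAdeleInr F (c.1 i).2, fun i => finiteAdeleInr F (c.2 i).2) := by
  refine Prod.ext (funext fun i => ?_) (funext fun i => ?_)
  · change c.1 i = 2 * infiniteAdeleInl F ((ringEquiv_mixedSpace F).symm
        (ringEquiv_mixedSpace F ((⅟(2 : AdeleRing (𝓞 F) F) * c.1 i).1))) + finiteAdeleInr F (c.1 i).2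
    rw [RingEquiv.symm_apply_apply]
    refine Prod.ext ?_ ?_
    · change (c.1 i).1 = ((2 : AdeleRing (𝓞 F) F) * (⅟(2 : AdeleRing (𝓞 F) F) * c.1 i)).1 + 0
      rw [add_zero, mul_invOf_cancel_left]
    · change (c.1 i).2 = (2 : AdeleRing (𝓞 F) F).2 * 0 + (c.1 i).2
      rw [mul_zero, zero_add]
  · change c.2 i = infiniteAdeleInl F ((ringEquiv_mixedSpace F).symm (ringEquiv_mixedSpace F (c.2 i).1)) +
        finiteAdeleInr F (c.2 i).2
    rw [RingEquiv.symm_apply_apply]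
    refine Prod.ext ?_ ?_
    · change (c.2 i).1 = (c.2 i).1 + 0
      rw [add_zero]
    · change (c.2 i).2 = 0 + (c.2 i).2
      rw [zero_add]

/-- archimedean coordinates of an archimedean vector: `arch (J_∞ v) = v`, and `fin (J_∞ v) = 0`; finite coordinates of a
finite vector: `fin (J_f u) = u`, `arch (J_f u) = 0` — recorded as the four coordinate identities.
[cite: GelbartRogawski1991, §3.1 p. 454 L17–22] -/
theorem arch_fin_coord (v : (Fin n → mixedSpace F) × (Fin n → mixedSpace F))
    (u : (Fin n → FiniteAdeleRing (𝓞 F) F) × (Fin n → FiniteAdeleRing (𝓞 F) F)) (i : Fin n) :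
    ringEquiv_mixedSpace F ((⅟(2 : AdeleRing (𝓞 F) F) *
        (2 * infiniteAdeleInl F ((ringEquiv_mixedSpace F).symm (v.1 i)) + finiteAdeleInr F (u.1 i))).1) = v.1 i ∧
      ringEquiv_mixedSpace F ((infiniteAdeleInl F ((ringEquiv_mixedSpace F).symm (v.2 i)) +
        finiteAdeleInr F (u.2 i)).1) = v.2 i ∧
      (2 * infiniteAdeleInl F ((ringEquiv_mixedSpace F).symm (v.1 i)) + finiteAdeleInr F (u.1 i)).2 = u.1 i ∧
      (infiniteAdeleInl F ((ringEquiv_mixedSpace F).symm (v.2 i)) + finiteAdeleInr F (u.2 i)).2 = u.2 i := by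
  refine ⟨?_, ?_, ?_, ?_⟩
  · have h : (⅟(2 : AdeleRing (𝓞 F) F) * (2 * infiniteAdeleInl F ((ringEquiv_mixedSpace F).symm (v.1 i)) +
        finiteAdeleInr F (u.1 i))).1 = (ringEquiv_mixedSpace F).symm (v.1 i) := by
      rw [mul_add, ← mul_assoc, invOf_mul_self, one_mul]
      change (ringEquiv_mixedSpace F).symm (v.1 i) + (⅟(2 : AdeleRing (𝓞 F) F)).1 * 0 = _
      rw [mul_zero, add_zero]
    rw [h, RingEquiv.apply_symm_apply]
  · change ringEquiv_mixedSpace F ((ringEquiv_mixedSpace F).symm (v.2 i) + 0) = v.2 i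
    rw [add_zero, RingEquiv.apply_symm_apply]
  · change (2 : AdeleRing (𝓞 F) F).2 * 0 + u.1 i = u.1 i
    rw [mul_zero, zero_add]
  · change (0 : FiniteAdeleRing (𝓞 F) F) + u.2 i = u.2 i
    rw [zero_add]

include he in
/-- **`heisForm` splits**: for `w = e c`, `w' = e c'`,
`heisForm w w' = (e⁻¹ (altPolar_∞ (arch c) (arch c')), ½ altPolar_f (fin c) (fin c'))` in `𝐀 = F_∞ × 𝐀_F^∞`.
[cite: GelbartRogawski1991, §3.1 p. 454 L17–22] -/
theorem heisForm_eq_arch_add_fin [Invertible (2 : FiniteAdeleRing (𝓞 F) F)]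
    (c c' : (Fin n → AdeleRing (𝓞 F) F) × (Fin n → AdeleRing (𝓞 F) F)) :
    heisForm F E V Φ (e c) (e c') =
      infiniteAdeleInl F ((ringEquiv_mixedSpace F).symm
        (altPolar (Matrix.toLinearMap₂' (mixedSpace F) (1 : Matrix (Fin n) (Fin n) (mixedSpace F)))
          (fun i => ringEquiv_mixedSpace F ((⅟(2 : AdeleRing (𝓞 F) F) * c.1 i).1),
            fun i => ringEquiv_mixedSpace F (c.2 i).1)
          (fun i => ringEquiv_mixedSpace F ((⅟(2 : AdeleRing (𝓞 F) F) * c'.1 i).1),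
            fun i => ringEquiv_mixedSpace F (c'.2 i).1))) +
      finiteAdeleInr F (((⅟(2 : FiniteAdeleRing (𝓞 F) F)) •
        altPolar (Matrix.toLinearMap₂' (FiniteAdeleRing (𝓞 F) F)
          (1 : Matrix (Fin n) (Fin n) (FiniteAdeleRing (𝓞 F) F))))
          (fun i => (c.1 i).2, fun i => (c.2 i).2) (fun i => (c'.1 i).2, fun i => (c'.2 i).2)) := by
  set v : (Fin n → mixedSpace F) × (Fin n → mixedSpace F) :=
    (fun i => ringEquiv_mixedSpace F ((⅟(2 : AdeleRing (𝓞 F) F) * c.1 i).1),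
      fun i => ringEquiv_mixedSpace F (c.2 i).1) with hv
  set v' : (Fin n → mixedSpace F) × (Fin n → mixedSpace F) :=
    (fun i => ringEquiv_mixedSpace F ((⅟(2 : AdeleRing (𝓞 F) F) * c'.1 i).1),
      fun i => ringEquiv_mixedSpace F (c'.2 i).1) with hv'
  set u : (Fin n → FiniteAdeleRing (𝓞 F) F) × (Fin n → FiniteAdeleRing (𝓞 F) F) :=
    (fun i => (c.1 i).2, fun i => (c.2 i).2) with hu
  set u' : (Fin n → FiniteAdeleRing (𝓞 F) F) × (Fin n → FiniteAdeleRing (𝓞 F) F) :=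
    (fun i => (c'.1 i).2, fun i => (c'.2 i).2) with hu'
  have hc : c = (fun i => 2 * infiniteAdeleInl F ((ringEquiv_mixedSpace F).symm (v.1 i)),
      fun i => infiniteAdeleInl F ((ringEquiv_mixedSpace F).symm (v.2 i))) +
      (fun i => finiteAdeleInr F (u.1 i), fun i => finiteAdeleInr F (u.2 i)) := coord_eq_arch_add_fin c
  have hc' : c' = (fun i => 2 * infiniteAdeleInl F ((ringEquiv_mixedSpace F).symm (v'.1 i)),
      fun i => infiniteAdeleInl F ((ringEquiv_mixedSpace F).symm (v'.2 i))) +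
      (fun i => finiteAdeleInr F (u'.1 i), fun i => finiteAdeleInr F (u'.2 i)) := coord_eq_arch_add_fin c'
  conv_lhs => rw [hc, hc', map_add, map_add, map_add, LinearMap.add_apply, map_add, map_add]
  rw [heisForm_coord_arch he v v', heisForm_coord_fin he u u', heisForm_coord_arch_fin he v u',
    heisForm_coord_fin_arch he v' u, add_zero, zero_add]

include he in
/-- **the projection `H_𝐀(W) → H(W_∞)`**: `(w, t) ↦ (arch(e⁻¹ w), ι(t_∞))` is a homomorphism onto the archimedean
Heisenberg group `Heisenberg (altPolar ·)` over `ℝ^{r₁} × ℂ^{r₂}` (`ι = ringEquiv_mixedSpace`).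
[cite: GelbartRogawski1991, §3.1 p. 454 L17–22] -/
theorem exists_archProj [Invertible (2 : FiniteAdeleRing (𝓞 F) F)] :
    ∃ p : AdelicHeisenberg F E V Φ →*
        Heisenberg (altPolar (Matrix.toLinearMap₂' (mixedSpace F) (1 : Matrix (Fin n) (Fin n) (mixedSpace F)))),
      ∀ (w : AdelicSpace F V) (t : AdeleRing (𝓞 F) F),
        p ⟨w, t⟩ = ⟨(fun i => ringEquiv_mixedSpace F ((⅟(2 : AdeleRing (𝓞 F) F) * (e.symm w).1 i).1),
          fun i => ringEquiv_mixedSpace F ((e.symm w).2 i).1), ringEquiv_mixedSpace F t.1⟩ := by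
  let arch : (Fin n → AdeleRing (𝓞 F) F) × (Fin n → AdeleRing (𝓞 F) F) →
      (Fin n → mixedSpace F) × (Fin n → mixedSpace F) := fun c =>
    (fun i => ringEquiv_mixedSpace F ((⅟(2 : AdeleRing (𝓞 F) F) * c.1 i).1),
      fun i => ringEquiv_mixedSpace F (c.2 i).1)
  have harch_add : ∀ c c', arch (c + c') = arch c + arch c' := fun c c' => by
    refine Prod.ext (funext fun i => ?_) (funext fun i => ?_)
    · change ringEquiv_mixedSpace F ((⅟(2 : AdeleRing (𝓞 F) F) * (c.1 i + c'.1 i)).1) =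
        ringEquiv_mixedSpace F ((⅟(2 : AdeleRing (𝓞 F) F) * c.1 i).1) +
          ringEquiv_mixedSpace F ((⅟(2 : AdeleRing (𝓞 F) F) * c'.1 i).1)
      rw [mul_add, ← map_add]
      rfl
    · change ringEquiv_mixedSpace F (c.2 i + c'.2 i).1 =
        ringEquiv_mixedSpace F (c.2 i).1 + ringEquiv_mixedSpace F (c'.2 i).1
      rw [← map_add]
      rfl
  have harch_zero : arch 0 = 0 := by
    have h := harch_add 0 0
    rw [add_zero] at h
    exact left_eq_add.1 h
  have hfst : ∀ c c' : (Fin n → AdeleRing (𝓞 F) F) × (Fin n → AdeleRing (𝓞 F) F),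
      ringEquiv_mixedSpace F (heisForm F E V Φ (e c) (e c')).1 =
        altPolar (Matrix.toLinearMap₂' (mixedSpace F) (1 : Matrix (Fin n) (Fin n) (mixedSpace F)))
          (arch c) (arch c') := by
    intro c c'
    rw [heisForm_eq_arch_add_fin he c c']
    change ringEquiv_mixedSpace F ((ringEquiv_mixedSpace F).symm _ + 0) = _
    rw [add_zero, RingEquiv.apply_symm_apply]
  refine ⟨{ toFun := fun h => ⟨arch (e.symm h.v), ringEquiv_mixedSpace F h.t.1⟩
            map_one' := ?_
            map_mul' := fun a b => ?_ }, fun w t => rfl⟩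
  · apply Heisenberg.ext
    · change arch (e.symm 0) = 0
      rw [map_zero, harch_zero]
    · change ringEquiv_mixedSpace F (0 : AdeleRing (𝓞 F) F).1 = 0
      exact map_zero _
  · apply Heisenberg.ext
    · change arch (e.symm (a.v + b.v)) = arch (e.symm a.v) + arch (e.symm b.v)
      rw [map_add, harch_add]
    · change ringEquiv_mixedSpace F (a.t + b.t + heisForm F E V Φ a.v b.v).1 =
        ringEquiv_mixedSpace F a.t.1 + ringEquiv_mixedSpace F b.t.1 +
          altPolar (Matrix.toLinearMap₂' (mixedSpace F) (1 : Matrix (Fin n) (Fin n) (mixedSpace F)))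
            (arch (e.symm a.v)) (arch (e.symm b.v))
      rw [← hfst, LinearEquiv.apply_symm_apply, LinearEquiv.apply_symm_apply, ← map_add, ← map_add]
      rfl

include he in
/-- **the projection `H_𝐀(W) → H(W_fin)`**: `(w, t) ↦ halfAltPolarEquiv (fin(e⁻¹ w), t_f)` is a homomorphism onto
the polarised finite-adelic Heisenberg group `Heisenberg (polar ·)` over `𝐀_F^∞`.
[cite: GelbartRogawski1991, §3.1 p. 454 L17–22] -/
theorem exists_finProj [Invertible (2 : FiniteAdeleRing (𝓞 F) F)] :
    ∃ p : AdelicHeisenberg F E V Φ →*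
        Heisenberg (polar (Matrix.toLinearMap₂' (FiniteAdeleRing (𝓞 F) F)
          (1 : Matrix (Fin n) (Fin n) (FiniteAdeleRing (𝓞 F) F)))),
      ∀ (w : AdelicSpace F V) (t : AdeleRing (𝓞 F) F),
        p ⟨w, t⟩ = halfAltPolarEquiv (Matrix.toLinearMap₂' (FiniteAdeleRing (𝓞 F) F)
          (1 : Matrix (Fin n) (Fin n) (FiniteAdeleRing (𝓞 F) F)))
          ⟨(fun i => ((e.symm w).1 i).2, fun i => ((e.symm w).2 i).2), t.2⟩ := by
  let fin : (Fin n → AdeleRing (𝓞 F) F) × (Fin n → AdeleRing (𝓞 F) F) →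
      (Fin n → FiniteAdeleRing (𝓞 F) F) × (Fin n → FiniteAdeleRing (𝓞 F) F) := fun c =>
    (fun i => (c.1 i).2, fun i => (c.2 i).2)
  have hfin_add : ∀ c c', fin (c + c') = fin c + fin c' := fun c c' => rfl
  have hfin_zero : fin 0 = 0 := rfl
  have hsnd : ∀ c c' : (Fin n → AdeleRing (𝓞 F) F) × (Fin n → AdeleRing (𝓞 F) F),
      (heisForm F E V Φ (e c) (e c')).2 =
        ((⅟(2 : FiniteAdeleRing (𝓞 F) F)) • altPolar (Matrix.toLinearMap₂' (FiniteAdeleRing (𝓞 F) F)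
          (1 : Matrix (Fin n) (Fin n) (FiniteAdeleRing (𝓞 F) F)))) (fin c) (fin c') := by
    intro c c'
    rw [heisForm_eq_arch_add_fin he c c']
    change (0 : FiniteAdeleRing (𝓞 F) F) + _ = _
    rw [zero_add]
    rfl
  let p' : AdelicHeisenberg F E V Φ →*
      Heisenberg ((⅟(2 : FiniteAdeleRing (𝓞 F) F)) • altPolar (Matrix.toLinearMap₂' (FiniteAdeleRing (𝓞 F) F)
        (1 : Matrix (Fin n) (Fin n) (FiniteAdeleRing (𝓞 F) F)))) :=
    { toFun := fun h => ⟨fin (e.symm h.v), h.t.2⟩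
      map_one' := by
        apply Heisenberg.ext
        · change fin (e.symm 0) = 0
          rw [map_zero, hfin_zero]
        · rfl
      map_mul' := fun a b => by
        apply Heisenberg.ext
        · change fin (e.symm (a.v + b.v)) = fin (e.symm a.v) + fin (e.symm b.v)
          rw [map_add, hfin_add]
        · change (a.t + b.t + heisForm F E V Φ a.v b.v).2 = a.t.2 + b.t.2 + _
          rw [← hsnd, LinearEquiv.apply_symm_apply, LinearEquiv.apply_symm_apply]
          rfl }
  exact ⟨(halfAltPolarEquiv (Matrix.toLinearMap₂' (FiniteAdeleRing (𝓞 F) F)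
      (1 : Matrix (Fin n) (Fin n) (FiniteAdeleRing (𝓞 F) F)))).toMonoidHom.comp p', fun w t => rfl⟩

/-- **sections of the two projections, I**: every element of `H(W_fin)` is the image of an element of `H_𝐀(W)` that
projects to `1` in `H(W_∞)`. [cite: GelbartRogawski1991, §3.1 p. 454 L17–22] -/
theorem exists_proj_eq_one_fin [Invertible (2 : FiniteAdeleRing (𝓞 F) F)]
    (p₁ : AdelicHeisenberg F E V Φ →*
      Heisenberg (altPolar (Matrix.toLinearMap₂' (mixedSpace F) (1 : Matrix (Fin n) (Fin n) (mixedSpace F)))))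
    (hp₁ : ∀ (w : AdelicSpace F V) (t : AdeleRing (𝓞 F) F),
      p₁ ⟨w, t⟩ = ⟨(fun i => ringEquiv_mixedSpace F ((⅟(2 : AdeleRing (𝓞 F) F) * (e.symm w).1 i).1),
        fun i => ringEquiv_mixedSpace F ((e.symm w).2 i).1), ringEquiv_mixedSpace F t.1⟩)
    (p₂ : AdelicHeisenberg F E V Φ →*
      Heisenberg (polar (Matrix.toLinearMap₂' (FiniteAdeleRing (𝓞 F) F)
        (1 : Matrix (Fin n) (Fin n) (FiniteAdeleRing (𝓞 F) F)))))
    (hp₂ : ∀ (w : AdelicSpace F V) (t : AdeleRing (𝓞 F) F),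
      p₂ ⟨w, t⟩ = halfAltPolarEquiv (Matrix.toLinearMap₂' (FiniteAdeleRing (𝓞 F) F)
        (1 : Matrix (Fin n) (Fin n) (FiniteAdeleRing (𝓞 F) F)))
        ⟨(fun i => ((e.symm w).1 i).2, fun i => ((e.symm w).2 i).2), t.2⟩)
    (u : (Fin n → FiniteAdeleRing (𝓞 F) F) × (Fin n → FiniteAdeleRing (𝓞 F) F)) (s : FiniteAdeleRing (𝓞 F) F) :
    ∃ g : AdelicHeisenberg F E V Φ, p₁ g = 1 ∧ p₂ g = ⟨u, s⟩ := by
  set c : (Fin n → AdeleRing (𝓞 F) F) × (Fin n → AdeleRing (𝓞 F) F) :=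
    (fun i => 2 * infiniteAdeleInl F ((ringEquiv_mixedSpace F).symm
        ((0 : (Fin n → mixedSpace F) × (Fin n → mixedSpace F)).1 i)) + finiteAdeleInr F (u.1 i),
      fun i => infiniteAdeleInl F ((ringEquiv_mixedSpace F).symm
        ((0 : (Fin n → mixedSpace F) × (Fin n → mixedSpace F)).2 i)) + finiteAdeleInr F (u.2 i)) with hc
  have hc1 : (fun i => (c.1 i).2) = u.1 := funext fun i => (arch_fin_coord (F := F) 0 u i).2.2.1
  have hc2 : (fun i => (c.2 i).2) = u.2 := funext fun i => (arch_fin_coord (F := F) 0 u i).2.2.2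
  refine ⟨⟨e c, finiteAdeleInr F (s - ⅟(2 : FiniteAdeleRing (𝓞 F) F) *
    Matrix.toLinearMap₂' (FiniteAdeleRing (𝓞 F) F) (1 : Matrix (Fin n) (Fin n) (FiniteAdeleRing (𝓞 F) F))
      u.1 u.2)⟩, ?_, ?_⟩
  · rw [hp₁, LinearEquiv.symm_apply_apply]
    apply Heisenberg.ext
    · refine Prod.ext (funext fun i => ?_) (funext fun i => ?_)
      · exact (arch_fin_coord (F := F) 0 u i).1
      · exact (arch_fin_coord (F := F) 0 u i).2.1
    · exact map_zero _
  · rw [hp₂, LinearEquiv.symm_apply_apply]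
    apply Heisenberg.ext
    · exact Prod.ext hc1 hc2
    · rw [halfAltPolarEquiv_apply_t]
      change s - _ + ⅟(2 : FiniteAdeleRing (𝓞 F) F) * Matrix.toLinearMap₂' (FiniteAdeleRing (𝓞 F) F)
        (1 : Matrix (Fin n) (Fin n) (FiniteAdeleRing (𝓞 F) F)) (fun i => (c.1 i).2) (fun i => (c.2 i).2) = s
      rw [hc1, hc2, sub_add_cancel]

/-- **sections of the two projections, II**: every element of `H(W_∞)` is the image of an element of `H_𝐀(W)` that
projects to `1` in `H(W_fin)`. [cite: GelbartRogawski1991, §3.1 p. 454 L17–22] -/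
theorem exists_proj_eq_one_arch [Invertible (2 : FiniteAdeleRing (𝓞 F) F)]
    (p₁ : AdelicHeisenberg F E V Φ →*
      Heisenberg (altPolar (Matrix.toLinearMap₂' (mixedSpace F) (1 : Matrix (Fin n) (Fin n) (mixedSpace F)))))
    (hp₁ : ∀ (w : AdelicSpace F V) (t : AdeleRing (𝓞 F) F),
      p₁ ⟨w, t⟩ = ⟨(fun i => ringEquiv_mixedSpace F ((⅟(2 : AdeleRing (𝓞 F) F) * (e.symm w).1 i).1),
        fun i => ringEquiv_mixedSpace F ((e.symm w).2 i).1), ringEquiv_mixedSpace F t.1⟩)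
    (p₂ : AdelicHeisenberg F E V Φ →*
      Heisenberg (polar (Matrix.toLinearMap₂' (FiniteAdeleRing (𝓞 F) F)
        (1 : Matrix (Fin n) (Fin n) (FiniteAdeleRing (𝓞 F) F)))))
    (hp₂ : ∀ (w : AdelicSpace F V) (t : AdeleRing (𝓞 F) F),
      p₂ ⟨w, t⟩ = halfAltPolarEquiv (Matrix.toLinearMap₂' (FiniteAdeleRing (𝓞 F) F)
        (1 : Matrix (Fin n) (Fin n) (FiniteAdeleRing (𝓞 F) F)))
        ⟨(fun i => ((e.symm w).1 i).2, fun i => ((e.symm w).2 i).2), t.2⟩)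
    (v : (Fin n → mixedSpace F) × (Fin n → mixedSpace F)) (s : mixedSpace F) :
    ∃ g : AdelicHeisenberg F E V Φ, p₁ g = ⟨v, s⟩ ∧ p₂ g = 1 := by
  set c : (Fin n → AdeleRing (𝓞 F) F) × (Fin n → AdeleRing (𝓞 F) F) :=
    (fun i => 2 * infiniteAdeleInl F ((ringEquiv_mixedSpace F).symm (v.1 i)) +
        finiteAdeleInr F ((0 : (Fin n → FiniteAdeleRing (𝓞 F) F) × (Fin n → FiniteAdeleRing (𝓞 F) F)).1 i),
      fun i => infiniteAdeleInl F ((ringEquiv_mixedSpace F).symm (v.2 i)) +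
        finiteAdeleInr F ((0 : (Fin n → FiniteAdeleRing (𝓞 F) F) × (Fin n → FiniteAdeleRing (𝓞 F) F)).2 i))
    with hc
  refine ⟨⟨e c, infiniteAdeleInl F ((ringEquiv_mixedSpace F).symm s)⟩, ?_, ?_⟩
  · rw [hp₁, LinearEquiv.symm_apply_apply]
    apply Heisenberg.ext
    · refine Prod.ext (funext fun i => ?_) (funext fun i => ?_)
      · exact (arch_fin_coord (F := F) v 0 i).1
      · exact (arch_fin_coord (F := F) v 0 i).2.1
    · exact (ringEquiv_mixedSpace F).apply_symm_apply s
  · rw [hp₂, LinearEquiv.symm_apply_apply]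
    have h0 : (⟨(fun i => (c.1 i).2, fun i => (c.2 i).2), (infiniteAdeleInl F ((ringEquiv_mixedSpace F).symm s)).2⟩ :
        Heisenberg ((⅟(2 : FiniteAdeleRing (𝓞 F) F)) • altPolar (Matrix.toLinearMap₂' (FiniteAdeleRing (𝓞 F) F)
          (1 : Matrix (Fin n) (Fin n) (FiniteAdeleRing (𝓞 F) F))))) = 1 := by
      apply Heisenberg.ext
      · refine Prod.ext (funext fun i => ?_) (funext fun i => ?_)
        · exact (arch_fin_coord (F := F) v 0 i).2.2.1
        · exact (arch_fin_coord (F := F) v 0 i).2.2.2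
      · rfl
    rw [h0]
    exact map_one (halfAltPolarEquiv _)

/-- **the projections on the centre**: `(0, t) ↦ (0, ι t_∞)` and `(0, t) ↦ (0, t_f)`.
[cite: GelbartRogawski1991, §3.1 p. 454 L17–22] -/
theorem proj_ofCenter [Invertible (2 : FiniteAdeleRing (𝓞 F) F)]
    (p₁ : AdelicHeisenberg F E V Φ →*
      Heisenberg (altPolar (Matrix.toLinearMap₂' (mixedSpace F) (1 : Matrix (Fin n) (Fin n) (mixedSpace F)))))
    (hp₁ : ∀ (w : AdelicSpace F V) (t : AdeleRing (𝓞 F) F),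
      p₁ ⟨w, t⟩ = ⟨(fun i => ringEquiv_mixedSpace F ((⅟(2 : AdeleRing (𝓞 F) F) * (e.symm w).1 i).1),
        fun i => ringEquiv_mixedSpace F ((e.symm w).2 i).1), ringEquiv_mixedSpace F t.1⟩)
    (p₂ : AdelicHeisenberg F E V Φ →*
      Heisenberg (polar (Matrix.toLinearMap₂' (FiniteAdeleRing (𝓞 F) F)
        (1 : Matrix (Fin n) (Fin n) (FiniteAdeleRing (𝓞 F) F)))))
    (hp₂ : ∀ (w : AdelicSpace F V) (t : AdeleRing (𝓞 F) F),
      p₂ ⟨w, t⟩ = halfAltPolarEquiv (Matrix.toLinearMap₂' (FiniteAdeleRing (𝓞 F) F)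
        (1 : Matrix (Fin n) (Fin n) (FiniteAdeleRing (𝓞 F) F)))
        ⟨(fun i => ((e.symm w).1 i).2, fun i => ((e.symm w).2 i).2), t.2⟩)
    (t : AdeleRing (𝓞 F) F) :
    p₁ (Heisenberg.ofCenter (heisForm F E V Φ) (Multiplicative.ofAdd t)) =
        Heisenberg.ofCenter _ (Multiplicative.ofAdd (ringEquiv_mixedSpace F t.1)) ∧
      p₂ (Heisenberg.ofCenter (heisForm F E V Φ) (Multiplicative.ofAdd t)) =
        Heisenberg.ofCenter _ (Multiplicative.ofAdd t.2) := by
  constructor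
  · change p₁ ⟨0, t⟩ = _
    rw [hp₁, map_zero]
    apply Heisenberg.ext
    · refine Prod.ext (funext fun i => ?_) (funext fun i => ?_)
      · change ringEquiv_mixedSpace F ((⅟(2 : AdeleRing (𝓞 F) F) * 0).1) = 0
        rw [mul_zero]
        exact map_zero _
      · exact map_zero _
    · rfl
  · change p₂ ⟨0, t⟩ = _
    rw [hp₂, map_zero, ← halfAltPolarEquiv_ofCenter _ (Multiplicative.ofAdd t.2)]
    rfl

end Coordinates

end Prop311

end Literature.NumberTheory.GelbartRogawski1991

end
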